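import Summits.Ventures.CertifiedManyBodySolver.Rows.TorusCeilingCoordSpinTwist
import Summits.Ventures.CertifiedManyBodySolver.Rows.TorusCeilingCRTSeam
import HarnessLib

/-!
# Spin-twisted torus ceiling VI — seam form (the ED convention) of the `L × ⋯ × L` spin-twisted torus

HONEST FRAMING: first certified bounds; not a superconductivity verdict; every number certified or
labelled float.
Dictionary between the two presentations of a boundary twist on the coordinate torus
`(Int.castAddHom (ZMod N)).compLeft (Fin d) : ℤ^d →+ (ℤ/N)^d` (Part V): the UNIFORM field (phase
`κ i σ` on every `i`-hop of species `σ`, the form in which the ceiling theorems are proved) and the ONE-SEAM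
field (phase `η i σ = (κ i σ)^N` on the `i`-hops leaving the last hyperplane `x_i = N − 1`, `1` elsewhere —
the convention of exact diagonalisation: periodic `η = 1`, antiperiodic `η = −1`, spin-antiperiodic
`η ↑ = i, η ↓ = −i`, …).  The coordinate gauge `g(x, σ) = ∏ᵢ (κ i σ)^{xᵢ}` carries one to the other
(`homSpinGaugeTransform_coordGauge`), so the sector ground energies agree
(`minEnergyOn_homHubbardSpinMag_coordSeam`), and the Part V ceiling holds verbatim for the seam
Hamiltonian with ANY seam table `η : Fin 2 → Fin 2 → U(1)`
(`coordSpinSeam_minEnergyOn_div_ge_of_window_certificate`) — literally the rows computed by the CAL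
spin-twist engine (cal-3 P-CAL-2, `spintwist/code/spinlib.py`: seam factors `b↑, b↓` per axis).
No new definitions: gauge and seam fields are written as explicit terms.
[cite: ShastrySutherland1990] [cite: Lieb1994, eq. (1)] [cite: Gros1992]
-/

noncomputable section

open Matrix Finset
open Literature.MathematicalPhysics.QuantumLattice
open Literature.MathematicalPhysics.QuantumFieldTheory hiding Site
open Literature.MathematicalPhysics.QuantumManyBody.StateRelaxation
open Literature.Probability.LatticeModels
open HubbardWave0
open scoped ComplexOrder ComplexConjugate

namespace Summit.Ventures.CertifiedManyBodySolver.Rows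

section CoordSeam

variable {d N : ℕ} [NeZero N]

/-- Coordinates after a hop on the coordinate torus: `(s + eᵢ)_j = s_j` for `j ≠ i` and
`(s + eᵢ)_i = (s_i + 1) mod N` (values in `[0, N)`). [folklore] -/
theorem val_add_coordHom_unitVec (s : TorusSite d N) (i j : Fin d) :
    ((s + (Int.castAddHom (ZMod N)).compLeft (Fin d) (unitVec i)) j).val =
      if j = i then ((s i).val + 1) % N else (s j).val := by
  rw [Pi.add_apply, coordHom_unitVec]
  by_cases h : j = i
  · subst h
    rw [if_pos rfl, Pi.single_eq_same, ZMod.val_add, ZMod.val_one_eq_one_mod, Nat.add_mod_mod]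
  · rw [if_neg h, Pi.single_eq_of_ne h, add_zero]

/-- **Uniform field = one-seam field on the coordinate torus.** The coordinate gauge
`g(s, σ) = ∏ⱼ (κ j σ)^{s_j}` carries the uniform spin-dependent field `κ` to the one-seam field with seam
phases `(κ i σ)^N` on the `i`-hops leaving the hyperplane `s_i = N − 1`. [cite: Lieb1994, eq. (1)]
[cite: ShastrySutherland1990] -/
theorem homSpinGaugeTransform_coordGauge (κ : Fin d → Fin 2 → Circle) :
    homSpinGaugeTransform ((Int.castAddHom (ZMod N)).compLeft (Fin d))
        (fun s σ => ∏ j, κ j σ ^ (s j).val) (fun _ => κ) =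
      fun s i σ => if (s i).val = N - 1 then κ i σ ^ N else 1 := by
  funext s i σ
  have hv : (s i).val < N := ZMod.val_lt (s i)
  have hP : ∀ e : Fin d → ℕ, (∏ j, κ j σ ^ e j) = (∏ j ∈ Finset.univ.erase i, κ j σ ^ e j) * κ i σ ^ e i :=
    fun e => (Finset.prod_erase_mul _ _ (Finset.mem_univ i)).symm
  have h1 : (∏ j, κ j σ ^ ((s + (Int.castAddHom (ZMod N)).compLeft (Fin d) (unitVec i)) j).val) =
      (∏ j ∈ Finset.univ.erase i, κ j σ ^ (s j).val) * κ i σ ^ (((s i).val + 1) % N) := by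
    rw [hP]
    congr 1
    · refine Finset.prod_congr rfl fun j hj => ?_
      rw [val_add_coordHom_unitVec, if_neg (Finset.ne_of_mem_erase hj)]
    · rw [val_add_coordHom_unitVec, if_pos rfl]
  simp only [homSpinGaugeTransform]
  rw [h1, hP (fun j => (s j).val)]
  generalize (∏ j ∈ Finset.univ.erase i, κ j σ ^ (s j).val) = P
  generalize (s i).val = v at hv ⊢
  by_cases h : v = N - 1
  · have e : (v + 1) % N = 0 := by
      rw [show v + 1 = N by omega, Nat.mod_self]
    rw [if_pos h, e, pow_zero, mul_one, mul_inv_eq_iff_eq_mul, mul_comm (κ i σ ^ N) P, mul_assoc, ← pow_succ,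
      show v + 1 = N by omega]
  · have e : (v + 1) % N = v + 1 := Nat.mod_eq_of_lt (by omega)
    rw [if_neg h, e, pow_succ, ← mul_assoc, mul_inv_cancel]

/-- Gauge covariance on the coordinate torus: the one-seam spin-dependent field with phases `(κ i σ)^N`
and the uniform field `κ` have the same sector ground energies. [cite: Lieb1994, eq. (1)] -/
theorem minEnergyOn_homHubbardSpinMag_coordSeam_pow (κ : Fin d → Fin 2 → Circle) (t U : ℝ) (n : ℕ)
    (M : ℝ) :
    (homHubbardSpinMag ((Int.castAddHom (ZMod N)).compLeft (Fin d))
        (fun s i σ => if (s i).val = N - 1 then κ i σ ^ N else 1) t U).minEnergyOn (szSector n M) =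
      (homHubbardSpinMag ((Int.castAddHom (ZMod N)).compLeft (Fin d)) (fun _ => κ) t U).minEnergyOn
        (szSector n M) := by
  rw [← homSpinGaugeTransform_coordGauge, minEnergyOn_szSector_homSpinGaugeTransform]

omit [NeZero N] in
/-- Every spin-dependent seam table is a table of `N`-th powers (`N ≥ 1`). [folklore] -/
theorem exists_pow_eq_circle_spinTable (η : Fin d → Fin 2 → Circle) (hN : N ≠ 0) :
    ∃ κ : Fin d → Fin 2 → Circle, ∀ i σ, κ i σ ^ N = η i σ := by
  choose κ hκ using fun i σ => exists_pow_eq_circle (η i σ) hN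
  exact ⟨κ, hκ⟩

/-- **One-seam spin-twisted coordinate torus = a uniformly twisted one**, for EVERY seam table
`η : Fin d → Fin 2 → U(1)` (`(κ i σ)^N = η i σ`), in every sector. [cite: Lieb1994, eq. (1)]
[cite: ShastrySutherland1990] [cite: Gros1992] -/
theorem minEnergyOn_homHubbardSpinMag_coordSeam (η : Fin d → Fin 2 → Circle) (t U : ℝ) (n : ℕ) (M : ℝ) :
    ∃ κ : Fin d → Fin 2 → Circle, (∀ i σ, κ i σ ^ N = η i σ) ∧
      (homHubbardSpinMag ((Int.castAddHom (ZMod N)).compLeft (Fin d))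
          (fun s i σ => if (s i).val = N - 1 then η i σ else 1) t U).minEnergyOn (szSector n M) =
        (homHubbardSpinMag ((Int.castAddHom (ZMod N)).compLeft (Fin d)) (fun _ => κ) t U).minEnergyOn
          (szSector n M) := by
  obtain ⟨κ, hκ⟩ := exists_pow_eq_circle_spinTable η (NeZero.ne N)
  refine ⟨κ, hκ, ?_⟩
  rw [← minEnergyOn_homHubbardSpinMag_coordSeam_pow]
  simp_rw [hκ]

end CoordSeam

section CoordSeamCeiling

/-! ### The `L × L` torus with every seam table `(b↑x, b↑y, b↓x, b↓y)` — the rows as computed -/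

/-- **Spin-twisted `L × L` torus in seam form, every seam table.** For `L ≥ 3`, a window of coordinate
spreads `≤ M`, `M + 1 ≤ L`, and every translation + EOM window certificate (data exactly as in
`coordSpinTwist_minEnergyOn_div_ge_of_window_certificate`): for EVERY seam table
`η : Fin 2 → Fin 2 → U(1)` (phase `η i σ` picked up by species `σ` on the `i`-hops leaving the hyperplane
`x_i = L − 1`, `1` on all other hops — the exact-diagonalisation convention), the energy density of the
seam Hamiltonian in every sector `(2n, S^z = 0)` is bounded below by the certified constant:
`c − Σ‖aₖ‖ + (Σ_σ μ_σ)(n/L² − ν) ≤ minEnergyOn (H_seam η) (szSector 2n 0) / L²`.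
[cite: ShastrySutherland1990] [cite: Han2020Bootstrap, §3] [cite: Lieb1994, eq. (1)] [cite: Gros1992] -/
theorem coordSpinSeam_minEnergyOn_div_ge_of_window_certificate (L : ℕ) [NeZero L] (hL : 3 ≤ L)
    (t U : ℝ) (η : Fin 2 → Fin 2 → Circle) {nh : ℕ} (hn : nh ≤ Fintype.card (FermionTorus 2 L))
    {Λ Λ' : Finset (Site 2)} (hΛ : Λ ⊆ Λ') {M : ℕ} (hM : M + 1 ≤ L)
    (hspread : ∀ x ∈ Λ', ∀ y ∈ Λ', ∀ i, |x i - y i| ≤ (M : ℤ))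
    (hclosed : ∀ x ∈ Λ, ∀ i : Fin 2, x + unitVec i ∈ Λ' ∧ x - unitVec i ∈ Λ')
    (h0 : thicken ({0} : Finset (Site 2)) 1 ⊆ Λ') (hz : (0 : Site 2) ∈ Λ')
    (μ : Fin 2 → ℝ) (ν : ℝ)
    {m : Type*} [Fintype m] [DecidableEq m] {Λm : Matrix m m ℂ} (hΛm : Λm.PosSemidef)
    (O : m → FermionOp Λ')
    {κ : Type*} (s : Finset κ) (B : κ → FermionOp Λ)
    {ι : Type*} (tt : Finset ι) (v : ι → Site 2) (hsh : ∀ l, shiftSet (v l) Λ ⊆ Λ') (Y : ι → FermionOp Λ)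
    {γ : Type*} (u : Finset γ) (b : γ → ℂ) (cw : γ → List (Orb (PolySite Λ') × Bool))
    (hcw : ∀ j ∈ u, ladderCharge (cw j) ≠ 0 ∨ ladderSpinCharge (cw j) ≠ 0)
    {δ : Type*} (ah : Finset δ) (dc : δ → ℝ) (V : δ → FermionOp Λ')
    {κ'' : Type*} (w : Finset κ'') (a : κ'' → ℂ) (word : κ'' → List (Orb (PolySite Λ') × Bool)) {c : ℝ}
    (hcert : fermionEmbed (PolySite.incl h0) ((hubbardFermionInteraction 2 t U).meanEnergyObs 1) -
        (c : ℂ) • (1 : FermionOp Λ') -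
        ∑ σ : Fin 2, ((μ σ : ℝ) : ℂ) • (nAt 0 hz σ - ((ν : ℝ) : ℂ) • (1 : FermionOp Λ')) =
      gramForm Λm O +
        (∑ k ∈ s, ((hubbardFermionInteraction 2 t U).localHamiltonian Λ' * fermionEmbed (PolySite.incl hΛ) (B k) -
            fermionEmbed (PolySite.incl hΛ) (B k) * (hubbardFermionInteraction 2 t U).localHamiltonian Λ') +
          ∑ l ∈ tt, (fermionEmbed (PolySite.incl (hsh l)) (fermionEmbed (PolySite.shiftEmb (v l) Λ) (Y l)) -
            fermionEmbed (PolySite.incl hΛ) (Y l)) +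
          ∑ j ∈ u, b j • ladderWord (cw j)) +
        (∑ m' ∈ ah, ((dc m' : ℝ) : ℂ) • ((V m')ᴴ - V m') + ∑ k ∈ w, a k • ladderWord (word k))) :
    c - ∑ k ∈ w, ‖a k‖ + (∑ σ : Fin 2, μ σ) * ((nh : ℝ) / (L : ℝ) ^ 2 - ν) ≤
      (homHubbardSpinMag ((Int.castAddHom (ZMod L)).compLeft (Fin 2))
          (fun x i σ => if (x i).val = L - 1 then η i σ else 1) t U).minEnergyOn (szSector (2 * nh) 0) /
        (L : ℝ) ^ 2 := by
  obtain ⟨κt, -, h⟩ := minEnergyOn_homHubbardSpinMag_coordSeam (N := L) η t U (2 * nh) 0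
  rw [h]
  exact coordSpinTwist_minEnergyOn_div_ge_of_window_certificate L hL t U κt hn hΛ hM hspread hclosed h0 hz
    μ ν hΛm O s B tt v hsh Y u b cw hcw ah dc V w a word hcert

end CoordSeamCeiling

end Summit.Ventures.CertifiedManyBodySolver.Rows

end
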